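import Literature.AlgebraicGeometry.Motives.HodgeStructurePeriodDomainOpen
import HarnessLib

/-!
# Approximate Hodge classes: a real vector close to `F^p` in the Hodge metric of a polarized Hodge structure of weight
# `2p` is close to its `(p,p)`-component, and its Hodge norm is close to `Q(v, v)^{1/2}` (Cattani–Deligne–Kaplan 2.15, 2.17 (iii))

Topic `Literature/AlgebraicGeometry/Motives` (namespace `Literature.AlgebraicGeometry.Motives.HodgeStructure`), a leaf on
`Motives/HodgeStructurePeriodDomainOpen.lean` (the Hodge norm `‖x‖_h² = Q_ℂ(Cx, x̄)` of a polarization `P` of a pure Hodge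
structure `H = (V, F)` of weight `n`: `Polarization.hodgeNorm`, Cauchy–Schwarz `norm_form_le`, the truncations `π_{≥p} = truncGE`,
`π_{<p} = truncLT`, the Hodge components `pieceProj`, orthogonality / Pythagoras `hodgeNorm_sq_pieceSMul_add_pieceSMul`,
`hodgeNorm_truncLT_le`, `hodgeNorm_sq_eq_pieceProj_add`). THEOREMS ONLY; no definition, no instance, no named fact (D-0026 net debt `0`).

PRINTED SOURCE, VERBATIM. E. Cattani, P. Deligne, A. Kaplan, *On the locus of Hodge classes*, J. Amer. Math. Soc. 8 (1995)
483–506. **2.15** (p. 491): «Our method of proof forces us to prove a result more general than 2.5, where the assumption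
`v ∈ Φ⁰(z)` is replaced by the assumption that `v` is close to `Φ⁰(z)`. In any hermitian space, given `α`, a quantity `Y`, a
nonzero vector `v`, and a subspace `F`, we will write `v ∼_Y F` if the sine of the angle between `v` and `F` is bounded by
`exp(−αY)`, i.e., if `v + w ∈ F` with `|w| ≤ exp(−αY)|v|`.»  **2.17** (p. 492), Remark (iii) to Theorem 2.16: «The condition
`v ∼_z Φ⁰(z)` implies that the ratio `Q(v, v)/‖v‖²_{Φ(z)}` is close to one. Instead of the condition `‖v‖_{Φ(z)} ≤ K`, we could
as well have required `Q(v, v) ≤ K`.»  (Weight `0`, type `(0,0)` in the source; here weight `n = p + p`, type `(p, p)`.)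

WHAT IS FORMALIZED, for a polarization `P` of a pure Hodge structure `H` of weight `n` on the `ℚ`-space `V`, Hodge norm
`‖·‖ = P.hodgeNorm`, and a vector `x ∈ V_ℂ` with a vector `f ∈ F^p` at Hodge distance `‖x − f‖` (the quantity `|w|` of 2.15):
* §1 the distance to `F^p` is realised by the truncation: `‖π_{<p} x‖ ≤ ‖x − f‖` for every `f ∈ F^p` and `x − π_{≥p} x = π_{<p} x`
  with `π_{≥p} x ∈ F^p` (`hodgeNorm_truncLT_le_hodgeNorm_sub_of_mem_F`, `exists_mem_F_hodgeNorm_sub_le_iff`);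
* §2 for `x` REAL (`x̄ = x`) and `n = p + p`: `x − x^{p,p} = π_{<p} x + π_{≥p+1} x`, `‖π_{≥p+1} x‖ = ‖π_{<p} x‖` (conjugation
  symmetry), hence **`‖x − x^{p,p}‖ ≤ 2‖x − f‖`** and `‖x − x^{p,p}‖² = 2‖π_{<p} x‖²` (`hodgeNorm_sub_pieceProj_le_two_mul`,
  `hodgeNorm_sub_pieceProj_sq_eq`): a real vector close to `F^p` is close to the space `H^{p,p}` of Hodge classes;
* §3 **2.17 (iii)**: `Q_ℂ(x^{p,p}, conj x^{p,p}) = ‖x^{p,p}‖²` (the Weil operator is `1` on `H^{p,p}`), and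
  **`|Q_ℂ(x, x̄) − ‖x‖²| ≤ 2‖x − x^{p,p}‖‖x‖ + 2‖x − x^{p,p}‖² ≤ 4‖x − f‖‖x‖ + 8‖x − f‖²`**; in the relative form of 2.15,
  `‖x − f‖ ≤ δ‖x‖` gives `|Re Q_ℂ(x, x̄) − ‖x‖²| ≤ (4δ + 8δ²)‖x‖²` («the ratio `Q(v,v)/‖v‖²` is close to one»), and for `δ ≤ 1/8`
  the two-sided comparison `‖x‖² ≤ 3 Re Q_ℂ(x, x̄)`, `Re Q_ℂ(x, x̄) ≤ 2‖x‖²`; for a rational class `x = 1 ⊗ u` these read with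
  `Q(u, u)` (`re_form_ofRat_conj_ofRat`, `abs_form_sub_hodgeNorm_ofRat_sq_le`, `hodgeNorm_ofRat_sq_le_three_mul_form`,
  `form_le_two_mul_hodgeNorm_ofRat_sq`) — so the hypotheses `‖v‖_{Φ(z)} ≤ K` and `Q(v, v) ≤ K` of Thm. 2.16 are interchangeable.

NOT HERE: the angle formalism itself (we carry the witness `f ∈ F^p` and the bound on `‖x − f‖` explicitly), Thm. 2.16.

## References

* [CattaniDeligneKaplan1995] E. Cattani, P. Deligne, A. Kaplan, *On the locus of Hodge classes*, J. Amer. Math. Soc. 8 (1995)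
  483–506: 2.15 (p. 491), Thm. 2.16 and Remarks 2.17 (ii)–(iii) (p. 492).
* [CarlsonMullerStachPeters2017] J. Carlson, S. Müller-Stach, C. Peters, *Period Mappings and Period Domains*, 2nd ed. (2017),
  §2.3 Thm. 2.3.3 and eq. (2.6) (the Hodge form `h_C(φ, ψ) = b(Cφ, ψ̄)`).
* [VoisinHodgeI2002] C. Voisin, *Hodge Theory and Complex Algebraic Geometry I* (2002), §7.1.2 Def. 7.7 (orthogonality of the
  Hodge decomposition).
-/

noncomputable section

open scoped TensorProduct ComplexOrder

namespace Literature.AlgebraicGeometry.Motives.HodgeStructure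

universe u

variable {V : Type u} [AddCommGroup V] [Module ℚ V] {n : ℤ}

/-! ## §1 Truncations: the distance to `F^p` is realised by `π_{<p}` -/

section Truncations

variable (H : HodgeStructure V n)

/-- `x − π_{≥p} x = π_{<p} x`. [cite: CattaniDeligneKaplan1995, 2.15 (p. 491)] -/
theorem sub_truncGE_eq_truncLT (p : ℤ) (x : ℂ ⊗[ℚ] V) : x - H.truncGE p x = H.truncLT p x := by
  rw [sub_eq_iff_eq_add, add_comm, truncGE_apply_add_truncLT_apply]

/-- `π_{<p} (x − f) = π_{<p} x` for `f ∈ F^p` (`π_{<p}` kills `F^p`). [cite: CattaniDeligneKaplan1995, 2.15 (p. 491)] -/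
theorem truncLT_sub_of_mem_F {p : ℤ} {f : ℂ ⊗[ℚ] V} (hf : f ∈ H.F p) (x : ℂ ⊗[ℚ] V) :
    H.truncLT p (x - f) = H.truncLT p x := by
  rw [map_sub, truncLT_apply_of_mem_F H hf, sub_zero]

/-- **`x − x^{p,n−p} = π_{<p} x + π_{≥p+1} x`**: off the component `(p, n−p)` a vector splits into its parts below and above `p`.
[cite: CattaniDeligneKaplan1995, 2.15 (p. 491)] [cite: VoisinHodgeI2002, §7.1.2 Def. 7.7] -/
theorem sub_pieceProj_eq_truncLT_add_truncGE_succ (p : ℤ) (x : ℂ ⊗[ℚ] V) :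
    x - H.pieceProj p x = H.truncLT p x + H.truncGE (p + 1) x := by
  have h1 := truncGE_apply_add_truncLT_apply H p x
  have h2 : H.pieceProj p x + H.truncGE (p + 1) x = H.truncGE p x := by
    rw [← LinearMap.add_apply, pieceProj_add_truncGE_succ]
  rw [sub_eq_iff_eq_add]
  calc x = H.truncGE p x + H.truncLT p x := h1.symm
    _ = H.pieceProj p x + H.truncGE (p + 1) x + H.truncLT p x := by rw [h2]
    _ = H.truncLT p x + H.truncGE (p + 1) x + H.pieceProj p x := by abel

/-- **Conjugation symmetry of the truncations in the middle weight: `conj (π_{≥p+1} x) = π_{<p} (x̄)` when `n = p + p`**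
(`conj H^{a,b} = H^{b,a}`, and `a ≥ p + 1 ⟺ b = n − a < p`). [cite: VoisinHodgeI2002, §7.1.1 Def. 7.4 and §7.1.2 Def. 7.7] -/
theorem conj_truncGE_succ_of_add_self {p : ℤ} (hp : p + p = n) (x : ℂ ⊗[ℚ] V) :
    conj (H.truncGE (p + 1) x) = H.truncLT p (conj x) := by
  rw [truncGE, conj_pieceSMul, truncLT]
  refine LinearMap.congr_fun (pieceSMul_congr H fun q => ?_) (conj x)
  by_cases h : q < p
  · rw [if_pos h, if_pos (by omega), map_one]
  · rw [if_neg h, if_neg (by omega), map_zero]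

/-- Symmetrically, `conj (π_{<p} x) = π_{≥p+1} (x̄)` when `n = p + p`. [cite: VoisinHodgeI2002, §7.1.1 Def. 7.4 and §7.1.2 Def. 7.7] -/
theorem conj_truncLT_of_add_self {p : ℤ} (hp : p + p = n) (x : ℂ ⊗[ℚ] V) :
    conj (H.truncLT p x) = H.truncGE (p + 1) (conj x) := by
  have h := H.conj_truncGE_succ_of_add_self hp (conj x)
  rw [conj_conj] at h
  rw [← h, conj_conj]

end Truncations

namespace Polarization

variable {H : HodgeStructure V n} (P : Polarization H)

/-- **The truncation realises the distance to `F^p`: `‖π_{<p} x‖ ≤ ‖x − f‖` for every `f ∈ F^p`** (`π_{<p}(x − f) = π_{<p} x` and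
`π_{<p}` does not increase the Hodge norm).  In the language of 2.15: if `v + w ∈ F` then `|π_{<p} v| ≤ |w|`.
[cite: CattaniDeligneKaplan1995, 2.15 (p. 491)] [cite: VoisinHodgeI2002, §7.1.2 Def. 7.7] -/
theorem hodgeNorm_truncLT_le_hodgeNorm_sub_of_mem_F {p : ℤ} {x f : ℂ ⊗[ℚ] V} (hf : f ∈ H.F p) :
    P.hodgeNorm (H.truncLT p x) ≤ P.hodgeNorm (x - f) := by
  rw [← truncLT_sub_of_mem_F H hf x]
  exact P.hodgeNorm_truncLT_le p (x - f)

/-- `‖x − π_{≥p} x‖ = ‖π_{<p} x‖`: the vector `π_{≥p} x ∈ F^p` is a witness of 2.15 with `|w| = ‖π_{<p} x‖`.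
[cite: CattaniDeligneKaplan1995, 2.15 (p. 491)] -/
theorem hodgeNorm_sub_truncGE_eq (p : ℤ) (x : ℂ ⊗[ℚ] V) : P.hodgeNorm (x - H.truncGE p x) = P.hodgeNorm (H.truncLT p x) := by
  rw [sub_truncGE_eq_truncLT]

/-- **`v ∼ F^p` with error `ε` iff `‖π_{<p} v‖ ≤ ε`**: there is `f ∈ F^p` with `‖x − f‖ ≤ ε` if and only if `‖π_{<p} x‖ ≤ ε`.
[cite: CattaniDeligneKaplan1995, 2.15 (p. 491)] -/
theorem exists_mem_F_hodgeNorm_sub_le_iff (p : ℤ) (x : ℂ ⊗[ℚ] V) (ε : ℝ) :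
    (∃ f ∈ H.F p, P.hodgeNorm (x - f) ≤ ε) ↔ P.hodgeNorm (H.truncLT p x) ≤ ε := by
  constructor
  · rintro ⟨f, hf, hε⟩
    exact (P.hodgeNorm_truncLT_le_hodgeNorm_sub_of_mem_F hf).trans hε
  · intro h
    exact ⟨H.truncGE p x, truncGE_mem_F H p x, by rwa [P.hodgeNorm_sub_truncGE_eq]⟩

/-- Monotonicity in the filtration: closeness to `F^{p'}` with `p ≤ p'` implies closeness to `F^p` (`F^{p'} ⊆ F^p`).
[cite: CattaniDeligneKaplan1995, 2.15 (p. 491)] -/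
theorem exists_mem_F_hodgeNorm_sub_le_of_le {p p' : ℤ} (hpp' : p ≤ p') {x : ℂ ⊗[ℚ] V} {ε : ℝ}
    (h : ∃ f ∈ H.F p', P.hodgeNorm (x - f) ≤ ε) : ∃ f ∈ H.F p, P.hodgeNorm (x - f) ≤ ε := by
  obtain ⟨f, hf, hε⟩ := h
  exact ⟨f, H.antitone_F hpp' hf, hε⟩

/-! ## §2 Real vectors in the middle weight: close to `F^p` ⟹ close to `H^{p,p}` -/

/-- **`‖π_{≥p+1} x‖ = ‖π_{<p} x‖` for `x` real and `n = p + p`** (`π_{≥p+1} x = conj (π_{<p} x̄) = conj (π_{<p} x)` and `conj` is a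
Hodge isometry). [cite: CattaniDeligneKaplan1995, 2.15 (p. 491)] [cite: CarlsonMullerStachPeters2017, §2.3 Thm. 2.3.3 and eq. (2.6)] -/
theorem hodgeNorm_truncGE_succ_eq_of_conj_eq {p : ℤ} (hp : p + p = n) {x : ℂ ⊗[ℚ] V} (hreal : conj x = x) :
    P.hodgeNorm (H.truncGE (p + 1) x) = P.hodgeNorm (H.truncLT p x) := by
  rw [← P.hodgeNorm_conj (H.truncGE (p + 1) x), conj_truncGE_succ_of_add_self H hp, hreal]

/-- **`‖x − x^{p,p}‖² = 2‖π_{<p} x‖²` for `x` real, `n = p + p`** (Pythagoras: `π_{<p} x ⊥ π_{≥p+1} x`, equal norms).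
[cite: CattaniDeligneKaplan1995, 2.15 (p. 491)] [cite: VoisinHodgeI2002, §7.1.2 Def. 7.7] -/
theorem hodgeNorm_sub_pieceProj_sq_eq {p : ℤ} (hp : p + p = n) {x : ℂ ⊗[ℚ] V} (hreal : conj x = x) :
    P.hodgeNorm (x - H.pieceProj p x) ^ 2 = 2 * P.hodgeNorm (H.truncLT p x) ^ 2 := by
  have h := P.hodgeNorm_sq_pieceSMul_add_pieceSMul (fun i => if i < p then (1 : ℂ) else 0)
    (fun i => if p + 1 ≤ i then (1 : ℂ) else 0) (fun i => by
      by_cases hi : i < p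
      · rw [if_pos hi, if_neg (by omega), mul_zero]
      · rw [if_neg hi, zero_mul]) x
  rw [sub_pieceProj_eq_truncLT_add_truncGE_succ]
  change P.hodgeNorm (H.truncLT p x + H.truncGE (p + 1) x) ^ 2 = _
  change P.hodgeNorm (H.truncLT p x + H.truncGE (p + 1) x) ^ 2 =
    P.hodgeNorm (H.truncLT p x) ^ 2 + P.hodgeNorm (H.truncGE (p + 1) x) ^ 2 at h
  rw [h, P.hodgeNorm_truncGE_succ_eq_of_conj_eq hp hreal]
  ring

/-- **A real vector close to `F^p` is close to the Hodge classes: `‖x − x^{p,p}‖ ≤ 2‖x − f‖`** for `x̄ = x`, `n = p + p` and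
every `f ∈ F^p` (`x − x^{p,p} = π_{<p} x + π_{≥p+1} x`, both of norm `≤ ‖x − f‖`).  2.15 with `F = Φ⁰(z)`: if `v ∼ Φ⁰(z)` with
error `|w|`, then `v` is within `2|w|` of its component of type `(0, 0)`. [cite: CattaniDeligneKaplan1995, 2.15 and 2.17 (iii) (pp. 491–492)] -/
theorem hodgeNorm_sub_pieceProj_le_two_mul {p : ℤ} (hp : p + p = n) {x : ℂ ⊗[ℚ] V} (hreal : conj x = x) {f : ℂ ⊗[ℚ] V}
    (hf : f ∈ H.F p) : P.hodgeNorm (x - H.pieceProj p x) ≤ 2 * P.hodgeNorm (x - f) := by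
  rw [sub_pieceProj_eq_truncLT_add_truncGE_succ]
  calc P.hodgeNorm (H.truncLT p x + H.truncGE (p + 1) x) ≤ P.hodgeNorm (H.truncLT p x) + P.hodgeNorm (H.truncGE (p + 1) x) :=
        P.hodgeNorm_add_le _ _
    _ = 2 * P.hodgeNorm (H.truncLT p x) := by rw [P.hodgeNorm_truncGE_succ_eq_of_conj_eq hp hreal]; ring
    _ ≤ 2 * P.hodgeNorm (x - f) := mul_le_mul_of_nonneg_left (P.hodgeNorm_truncLT_le_hodgeNorm_sub_of_mem_F hf) (by norm_num)

/-- The relative form: `‖x − f‖ ≤ δ‖x‖` with `f ∈ F^p`, `x` real, `n = p + p` ⟹ `‖x − x^{p,p}‖ ≤ 2δ‖x‖`.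
[cite: CattaniDeligneKaplan1995, 2.15 and 2.17 (iii) (pp. 491–492)] -/
theorem hodgeNorm_sub_pieceProj_le_of_hodgeNorm_sub_le {p : ℤ} (hp : p + p = n) {x : ℂ ⊗[ℚ] V} (hreal : conj x = x)
    {f : ℂ ⊗[ℚ] V} (hf : f ∈ H.F p) {δ : ℝ} (hδ : P.hodgeNorm (x - f) ≤ δ * P.hodgeNorm x) :
    P.hodgeNorm (x - H.pieceProj p x) ≤ 2 * δ * P.hodgeNorm x := by
  have h := P.hodgeNorm_sub_pieceProj_le_two_mul hp hreal hf
  nlinarith [P.hodgeNorm_nonneg (x - f)]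

/-- The component `x^{p,p}` of a real vector is real (`n = p + p`). [cite: VoisinHodgeI2002, §7.1.1 Def. 7.4] -/
theorem conj_pieceProj_of_add_self {p : ℤ} (hp : p + p = n) {x : ℂ ⊗[ℚ] V} (hreal : conj x = x) :
    conj (H.pieceProj p x) = H.pieceProj p x := by
  rw [conj_pieceProj, hreal, show n - p = p by omega]

/-- The component `x^{p,p}` is a Hodge class: `x^{p,p} ∈ H^{p,p} = F^p ∩ conj F^p` (`n = p + p`). [cite: VoisinHodgeI2002, §7.1.1 Def. 7.4] -/
theorem pieceProj_mem_piece_of_add_self {p : ℤ} (hp : p + p = n) (x : ℂ ⊗[ℚ] V) : H.pieceProj p x ∈ H.piece p p := by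
  have h := pieceProj_mem H p x
  rwa [show n - p = p by omega] at h

/-! ## §3 CDK 2.17 (iii): `Q(v, v)/‖v‖²` is close to one -/

/-- **On Hodge classes the polarization IS the Hodge norm: `Q_ℂ(x^{p,p}, conj x^{p,p}) = ‖x^{p,p}‖²`** (`n = p + p`; the Weil
operator `i^p/i^{n−p}` is `1` on `H^{p,p}`). [cite: CarlsonMullerStachPeters2017, §2.3 Thm. 2.3.3 and eq. (2.6)] [cite: CattaniDeligneKaplan1995, 2.17 (iii) (p. 492)] -/
theorem form_pieceProj_conj_pieceProj_eq_hodgeNorm_sq {p : ℤ} (hp : p + p = n) (x : ℂ ⊗[ℚ] V) :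
    P.form.baseChange ℂ (H.pieceProj p x) (conj (H.pieceProj p x)) = ((P.hodgeNorm (H.pieceProj p x) ^ 2 : ℝ) : ℂ) := by
  have h := P.hodgeSign_mul_form_pieceProj_conj_pieceProj p x
  have hsign : hodgeSign n p = 1 := by
    rw [hodgeSign, show n - p = p by omega, mul_inv_cancel₀ (zpow_ne_zero _ Complex.I_ne_zero)]
  rwa [hsign, one_mul] at h

/-- **`|Q_ℂ(x, x̄) − ‖x‖²| ≤ 2‖x − x^{p,p}‖‖x‖ + 2‖x − x^{p,p}‖²`** for every `x ∈ V_ℂ` (`n = p + p`): with `π = x^{p,p}`, `r = x − π`,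
`Q_ℂ(x, x̄) − ‖x‖² = Q_ℂ(π, r̄) + Q_ℂ(r, π̄) + Q_ℂ(r, r̄) − ‖r‖²` (orthogonality `‖x‖² = ‖π‖² + ‖r‖²`, `Q_ℂ(π, π̄) = ‖π‖²`) and
Cauchy–Schwarz `|Q_ℂ(a, b)| ≤ ‖a‖‖b‖`. [cite: CattaniDeligneKaplan1995, 2.17 (iii) (p. 492)] [cite: CarlsonMullerStachPeters2017, §2.3 Thm. 2.3.3 and eq. (2.6)] -/
theorem norm_form_self_conj_sub_hodgeNorm_sq_le {p : ℤ} (hp : p + p = n) (x : ℂ ⊗[ℚ] V) :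
    ‖P.form.baseChange ℂ x (conj x) - ((P.hodgeNorm x ^ 2 : ℝ) : ℂ)‖ ≤
      2 * P.hodgeNorm (x - H.pieceProj p x) * P.hodgeNorm x + 2 * P.hodgeNorm (x - H.pieceProj p x) ^ 2 := by
  set π := H.pieceProj p x with hπ_def
  set r := x - π with hr_def
  have hx : x = π + r := by rw [hr_def]; abel
  have hsq : P.hodgeNorm x ^ 2 = P.hodgeNorm π ^ 2 + P.hodgeNorm r ^ 2 := P.hodgeNorm_sq_eq_pieceProj_add p x
  have hππ : P.form.baseChange ℂ π (conj π) = ((P.hodgeNorm π ^ 2 : ℝ) : ℂ) := P.form_pieceProj_conj_pieceProj_eq_hodgeNorm_sq hp x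
  -- expand `Q_ℂ(x, x̄)`
  have hQ : P.form.baseChange ℂ x (conj x) = P.form.baseChange ℂ π (conj π) + P.form.baseChange ℂ π (conj r) +
      (P.form.baseChange ℂ r (conj π) + P.form.baseChange ℂ r (conj r)) := by
    rw [hx, map_add conj, LinearMap.map_add₂, map_add, map_add]
  have hexp : P.form.baseChange ℂ x (conj x) - ((P.hodgeNorm x ^ 2 : ℝ) : ℂ) =
      P.form.baseChange ℂ π (conj r) + P.form.baseChange ℂ r (conj π) + (P.form.baseChange ℂ r (conj r) - ((P.hodgeNorm r ^ 2 : ℝ) : ℂ)) := by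
    rw [hQ, hππ, hsq]
    push_cast
    ring
  have hπle : P.hodgeNorm π ≤ P.hodgeNorm x := P.hodgeNorm_pieceProj_le p x
  have hrle : P.hodgeNorm r ≤ P.hodgeNorm x := by
    have h0 := P.hodgeNorm_nonneg π
    have h1 := P.hodgeNorm_nonneg r
    have h2 := P.hodgeNorm_nonneg x
    nlinarith [hsq]
  have h1 : ‖P.form.baseChange ℂ π (conj r)‖ ≤ P.hodgeNorm x * P.hodgeNorm r := by
    calc ‖P.form.baseChange ℂ π (conj r)‖ ≤ P.hodgeNorm π * P.hodgeNorm (conj r) := P.norm_form_le _ _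
      _ = P.hodgeNorm π * P.hodgeNorm r := by rw [P.hodgeNorm_conj]
      _ ≤ P.hodgeNorm x * P.hodgeNorm r := mul_le_mul_of_nonneg_right hπle (P.hodgeNorm_nonneg _)
  have h2 : ‖P.form.baseChange ℂ r (conj π)‖ ≤ P.hodgeNorm r * P.hodgeNorm x := by
    calc ‖P.form.baseChange ℂ r (conj π)‖ ≤ P.hodgeNorm r * P.hodgeNorm (conj π) := P.norm_form_le _ _
      _ = P.hodgeNorm r * P.hodgeNorm π := by rw [P.hodgeNorm_conj]
      _ ≤ P.hodgeNorm r * P.hodgeNorm x := mul_le_mul_of_nonneg_left hπle (P.hodgeNorm_nonneg _)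
  have h3 : ‖P.form.baseChange ℂ r (conj r) - ((P.hodgeNorm r ^ 2 : ℝ) : ℂ)‖ ≤ 2 * P.hodgeNorm r ^ 2 := by
    calc ‖P.form.baseChange ℂ r (conj r) - ((P.hodgeNorm r ^ 2 : ℝ) : ℂ)‖
        ≤ ‖P.form.baseChange ℂ r (conj r)‖ + ‖((P.hodgeNorm r ^ 2 : ℝ) : ℂ)‖ := norm_sub_le _ _
      _ ≤ P.hodgeNorm r * P.hodgeNorm (conj r) + P.hodgeNorm r ^ 2 := by
          refine add_le_add (P.norm_form_le _ _) ?_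
          rw [Complex.norm_real, Real.norm_eq_abs, abs_of_nonneg (sq_nonneg _)]
      _ = 2 * P.hodgeNorm r ^ 2 := by rw [P.hodgeNorm_conj]; ring
  rw [hexp]
  calc ‖P.form.baseChange ℂ π (conj r) + P.form.baseChange ℂ r (conj π) +
        (P.form.baseChange ℂ r (conj r) - ((P.hodgeNorm r ^ 2 : ℝ) : ℂ))‖
      ≤ ‖P.form.baseChange ℂ π (conj r)‖ + ‖P.form.baseChange ℂ r (conj π)‖ +
          ‖P.form.baseChange ℂ r (conj r) - ((P.hodgeNorm r ^ 2 : ℝ) : ℂ)‖ := norm_add₃_le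
    _ ≤ P.hodgeNorm x * P.hodgeNorm r + P.hodgeNorm r * P.hodgeNorm x + 2 * P.hodgeNorm r ^ 2 := by linarith
    _ = 2 * P.hodgeNorm r * P.hodgeNorm x + 2 * P.hodgeNorm r ^ 2 := by ring

/-- **CDK 2.17 (iii), absolute form: `|Q_ℂ(x, x̄) − ‖x‖²| ≤ 4‖x − f‖‖x‖ + 8‖x − f‖²`** for `x` real (`x̄ = x`), `n = p + p`, and any
`f ∈ F^p` — the self-intersection of a real vector close to `F^p` is close to its squared Hodge norm.
[cite: CattaniDeligneKaplan1995, 2.17 (iii) (p. 492)] -/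
theorem norm_form_self_conj_sub_hodgeNorm_sq_le_of_mem_F {p : ℤ} (hp : p + p = n) {x : ℂ ⊗[ℚ] V} (hreal : conj x = x)
    {f : ℂ ⊗[ℚ] V} (hf : f ∈ H.F p) :
    ‖P.form.baseChange ℂ x (conj x) - ((P.hodgeNorm x ^ 2 : ℝ) : ℂ)‖ ≤
      4 * P.hodgeNorm (x - f) * P.hodgeNorm x + 8 * P.hodgeNorm (x - f) ^ 2 := by
  have h := P.norm_form_self_conj_sub_hodgeNorm_sq_le hp x
  have hr := P.hodgeNorm_sub_pieceProj_le_two_mul hp hreal hf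
  have h0 := P.hodgeNorm_nonneg (x - H.pieceProj p x)
  have h1 := P.hodgeNorm_nonneg x
  have h2 := P.hodgeNorm_nonneg (x - f)
  nlinarith

/-- **CDK 2.17 (iii), relative form: `‖x − f‖ ≤ δ‖x‖` (`v ∼ F^p` with error `δ`) ⟹ `|Re Q_ℂ(x, x̄) − ‖x‖²| ≤ (4δ + 8δ²)‖x‖²`** for
`x` real and `n = p + p` — «the ratio `Q(v, v)/‖v‖²` is close to one». [cite: CattaniDeligneKaplan1995, 2.17 (iii) (p. 492)] -/
theorem abs_re_form_self_conj_sub_hodgeNorm_sq_le {p : ℤ} (hp : p + p = n) {x : ℂ ⊗[ℚ] V} (hreal : conj x = x)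
    {f : ℂ ⊗[ℚ] V} (hf : f ∈ H.F p) {δ : ℝ} (hδ : P.hodgeNorm (x - f) ≤ δ * P.hodgeNorm x) :
    |(P.form.baseChange ℂ x (conj x)).re - P.hodgeNorm x ^ 2| ≤ (4 * δ + 8 * δ ^ 2) * P.hodgeNorm x ^ 2 := by
  have h := P.norm_form_self_conj_sub_hodgeNorm_sq_le_of_mem_F hp hreal hf
  have hre : |(P.form.baseChange ℂ x (conj x)).re - P.hodgeNorm x ^ 2| ≤
      ‖P.form.baseChange ℂ x (conj x) - ((P.hodgeNorm x ^ 2 : ℝ) : ℂ)‖ := by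
    have e : (P.form.baseChange ℂ x (conj x)).re - P.hodgeNorm x ^ 2 =
        (P.form.baseChange ℂ x (conj x) - ((P.hodgeNorm x ^ 2 : ℝ) : ℂ)).re := by
      rw [Complex.sub_re, Complex.ofReal_re]
    rw [e]
    exact Complex.abs_re_le_norm _
  have hδ0 : 0 ≤ δ * P.hodgeNorm x := (P.hodgeNorm_nonneg _).trans hδ
  have h1 := P.hodgeNorm_nonneg x
  have h2 := P.hodgeNorm_nonneg (x - f)
  have h3 : P.hodgeNorm (x - f) * P.hodgeNorm x ≤ δ * P.hodgeNorm x * P.hodgeNorm x := mul_le_mul_of_nonneg_right hδ h1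
  have h4 : P.hodgeNorm (x - f) ^ 2 ≤ (δ * P.hodgeNorm x) ^ 2 := pow_le_pow_left₀ h2 hδ 2
  nlinarith

/-- **For `δ ≤ 1/8`: `‖x‖² ≤ 3 Re Q_ℂ(x, x̄)`** (`x` real, `n = p + p`, `‖x − f‖ ≤ δ‖x‖`, `f ∈ F^p`) — a bound on `Q(v, v)` bounds the
Hodge norm of an approximate Hodge class. [cite: CattaniDeligneKaplan1995, 2.17 (iii) (p. 492)] -/
theorem hodgeNorm_sq_le_three_mul_re_form {p : ℤ} (hp : p + p = n) {x : ℂ ⊗[ℚ] V} (hreal : conj x = x) {f : ℂ ⊗[ℚ] V}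
    (hf : f ∈ H.F p) {δ : ℝ} (hδ : P.hodgeNorm (x - f) ≤ δ * P.hodgeNorm x) (hδ0 : 0 ≤ δ) (hδ8 : δ ≤ 1 / 8) :
    P.hodgeNorm x ^ 2 ≤ 3 * (P.form.baseChange ℂ x (conj x)).re := by
  have h := P.abs_re_form_self_conj_sub_hodgeNorm_sq_le hp hreal hf hδ
  have hc : 4 * δ + 8 * δ ^ 2 ≤ 5 / 8 := by nlinarith
  have h1 : (4 * δ + 8 * δ ^ 2) * P.hodgeNorm x ^ 2 ≤ 5 / 8 * P.hodgeNorm x ^ 2 := mul_le_mul_of_nonneg_right hc (sq_nonneg _)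
  have h2 := (abs_le.1 (h.trans h1)).1
  nlinarith [sq_nonneg (P.hodgeNorm x)]

/-- **For `δ ≤ 1/8`: `Re Q_ℂ(x, x̄) ≤ 2‖x‖²`** (same hypotheses) — a bound on the Hodge norm bounds `Q(v, v)`.
[cite: CattaniDeligneKaplan1995, 2.17 (iii) (p. 492)] -/
theorem re_form_le_two_mul_hodgeNorm_sq {p : ℤ} (hp : p + p = n) {x : ℂ ⊗[ℚ] V} (hreal : conj x = x) {f : ℂ ⊗[ℚ] V}
    (hf : f ∈ H.F p) {δ : ℝ} (hδ : P.hodgeNorm (x - f) ≤ δ * P.hodgeNorm x) (hδ0 : 0 ≤ δ) (hδ8 : δ ≤ 1 / 8) :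
    (P.form.baseChange ℂ x (conj x)).re ≤ 2 * P.hodgeNorm x ^ 2 := by
  have h := P.abs_re_form_self_conj_sub_hodgeNorm_sq_le hp hreal hf hδ
  have hc : 4 * δ + 8 * δ ^ 2 ≤ 5 / 8 := by nlinarith
  have h1 : (4 * δ + 8 * δ ^ 2) * P.hodgeNorm x ^ 2 ≤ 5 / 8 * P.hodgeNorm x ^ 2 := mul_le_mul_of_nonneg_right hc (sq_nonneg _)
  have h2 := (abs_le.1 (h.trans h1)).2
  nlinarith [sq_nonneg (P.hodgeNorm x)]

/-! ### Rational classes `x = 1 ⊗ u`: `Q_ℂ(1 ⊗ u, conj (1 ⊗ u)) = Q(u, u)` -/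

/-- `Q_ℂ(1 ⊗ u, conj (1 ⊗ u)) = Q(u, u)` (real part; the value is the rational number `Q(u, u)`): the self-intersection `Q(v, v)` of
an integral class as it enters 2.5 / 2.17 (iii). [cite: CattaniDeligneKaplan1995, 2.17 (iii) (p. 492) and §1 (p. 484, "Q(u, u)")] -/
theorem re_form_ofRat_conj_ofRat (u : V) : (P.form.baseChange ℂ (ofRat u) (conj (ofRat u))).re = ((P.form u u : ℚ) : ℝ) := by
  rw [conj_ofRat, ofRat_apply, LinearMap.BilinForm.baseChange_tmul, mul_one,
    show ((P.form u u : ℚ) : ℚ) • (1 : ℂ) = (((P.form u u : ℚ) : ℝ) : ℂ) by rw [Rat.smul_one_eq_cast]; norm_cast, Complex.ofReal_re]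

/-- **CDK 2.17 (iii) for a rational class: `|Q(u, u) − ‖1 ⊗ u‖²| ≤ (4δ + 8δ²)‖1 ⊗ u‖²`** when `‖1 ⊗ u − f‖ ≤ δ‖1 ⊗ u‖` for some
`f ∈ F^p` (`n = p + p`). [cite: CattaniDeligneKaplan1995, 2.17 (iii) (p. 492)] -/
theorem abs_form_sub_hodgeNorm_ofRat_sq_le {p : ℤ} (hp : p + p = n) {u : V} {f : ℂ ⊗[ℚ] V} (hf : f ∈ H.F p) {δ : ℝ}
    (hδ : P.hodgeNorm (ofRat u - f) ≤ δ * P.hodgeNorm (ofRat u)) :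
    |((P.form u u : ℚ) : ℝ) - P.hodgeNorm (ofRat u) ^ 2| ≤ (4 * δ + 8 * δ ^ 2) * P.hodgeNorm (ofRat u) ^ 2 := by
  rw [← P.re_form_ofRat_conj_ofRat u]
  exact P.abs_re_form_self_conj_sub_hodgeNorm_sq_le hp (conj_ofRat u) hf hδ

/-- **`‖1 ⊗ u‖² ≤ 3 Q(u, u)`** for a rational class within `δ‖1 ⊗ u‖` of `F^p`, `δ ≤ 1/8` (`n = p + p`): «instead of the condition
`‖v‖_{Φ(z)} ≤ K`, we could as well have required `Q(v, v) ≤ K`». [cite: CattaniDeligneKaplan1995, 2.17 (iii) (p. 492)] -/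
theorem hodgeNorm_ofRat_sq_le_three_mul_form {p : ℤ} (hp : p + p = n) {u : V} {f : ℂ ⊗[ℚ] V} (hf : f ∈ H.F p) {δ : ℝ}
    (hδ : P.hodgeNorm (ofRat u - f) ≤ δ * P.hodgeNorm (ofRat u)) (hδ0 : 0 ≤ δ) (hδ8 : δ ≤ 1 / 8) :
    P.hodgeNorm (ofRat u) ^ 2 ≤ 3 * ((P.form u u : ℚ) : ℝ) := by
  rw [← P.re_form_ofRat_conj_ofRat u]
  exact P.hodgeNorm_sq_le_three_mul_re_form hp (conj_ofRat u) hf hδ hδ0 hδ8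

/-- **`Q(u, u) ≤ 2‖1 ⊗ u‖²`** for a rational class within `δ‖1 ⊗ u‖` of `F^p`, `δ ≤ 1/8` (`n = p + p`).
[cite: CattaniDeligneKaplan1995, 2.17 (iii) (p. 492)] -/
theorem form_le_two_mul_hodgeNorm_ofRat_sq {p : ℤ} (hp : p + p = n) {u : V} {f : ℂ ⊗[ℚ] V} (hf : f ∈ H.F p) {δ : ℝ}
    (hδ : P.hodgeNorm (ofRat u - f) ≤ δ * P.hodgeNorm (ofRat u)) (hδ0 : 0 ≤ δ) (hδ8 : δ ≤ 1 / 8) :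
    ((P.form u u : ℚ) : ℝ) ≤ 2 * P.hodgeNorm (ofRat u) ^ 2 := by
  rw [← P.re_form_ofRat_conj_ofRat u]
  exact P.re_form_le_two_mul_hodgeNorm_sq hp (conj_ofRat u) hf hδ hδ0 hδ8

/-- **The Hodge norm of an approximate rational Hodge class with `Q(u, u) ≤ K` is bounded: `‖1 ⊗ u‖ ≤ √(3K)`** (`δ ≤ 1/8`).
[cite: CattaniDeligneKaplan1995, 2.17 (iii) (p. 492)] -/
theorem hodgeNorm_ofRat_le_sqrt_of_form_le {p : ℤ} (hp : p + p = n) {u : V} {f : ℂ ⊗[ℚ] V} (hf : f ∈ H.F p) {δ : ℝ}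
    (hδ : P.hodgeNorm (ofRat u - f) ≤ δ * P.hodgeNorm (ofRat u)) (hδ0 : 0 ≤ δ) (hδ8 : δ ≤ 1 / 8) {K : ℝ}
    (hK : ((P.form u u : ℚ) : ℝ) ≤ K) : P.hodgeNorm (ofRat u) ≤ Real.sqrt (3 * K) := by
  have h := P.hodgeNorm_ofRat_sq_le_three_mul_form hp hf hδ hδ0 hδ8
  rw [← Real.sqrt_sq (P.hodgeNorm_nonneg (ofRat u))]
  exact Real.sqrt_le_sqrt (by linarith)

end Polarization

end Literature.AlgebraicGeometry.Motives.HodgeStructure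

end
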